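import Summits.ABC.IUTFork.Conditional.Layer3OfS
import Literature.AnabelianGeometry.SemiGraphs.TemperedReconstructionCor39LiteralRefutation

/-!
# L3 LAYER CERTIFICATE — the LITERAL residual `Layer3Residual` is UNSATISFIABLE at universe 0 (K-hazard certificate)

abc-iut cell, branch C «CONDITIONAL VERIFICATION abc ⇐ S» (rung LADDER-ABC:A2.C); PROOF-ONLY sibling of
`Conditional/Layer3OfS.lean` (holder abc-iut-w6-d045; this file: abc-iut-w4-d011 gen 4, C-R5a kernel-status companion, KERNEL MOVE #30).
No `def`, no new `Prop`; nothing is restated.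

WHAT IS CERTIFIED. `Layer3OfS.lean` offers the apex two L3 binders: the LITERAL residual
`Layer3Residual := CompactInVerticial ∧ MaximalCompactIffVerticial ∧ Cor39` and the READING-OF-RECORD residual
`Layer3ResidualOfRecord := CompactInVerticial ∧ MaximalCompactIffVerticial ∧ Cor39CompatUpToTwist` (L3-lead rulings χ2 / ξ2), and says
of the former «OPEN-AS-TYPED, refutable in principle» and that its R-def (b) inhabitation certificate «is NOT available and NOT claimed».
Since abc-iut-f-175 LANDED `Literature.AnabelianGeometry.SemiGraphs.IwahoriWitness.not_cor39 : ¬ Cor39.{0}` (p439444,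
`TemperedReconstructionCor39LiteralRefutation.lean`: the fold `doubleLoop 2 → loopGraph 2` of the estranged Iwahori loop is literally
quasi-geometric but induced by no locally open morphism — FACT-LIST row F-1710 REFUTED AS TYPED), the literal residual is now
KERNEL-UNSATISFIABLE at `u₁ = 0`:

* `not_layer3Residual` : `¬ Layer3Residual.{0}` — hence every theorem binding `(h : Layer3Residual.{0})` (`layer3Cone_of`,
  `layer3Residual_of_core` at universe 0) is VACUOUSLY conditional there (K-hazard class «refuted binder»);
* `not_layer3Cone` : `¬ Layer3Cone.{0, u₂, u₃, u₄, u₅}`;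
* `layer3Residual_iff_false` : at universe 0 the literal residual is `False` — recorded so that hypothesis audits can cite ONE name.

WHAT IS NOT AFFECTED (recorded BY NAME, proved in `Layer3OfS.lean` already, re-exported here at universe 0 for the audit's convenience):
the reading of record `Layer3ResidualOfRecord.{0}` still follows from the ONE named fact `CompactInVerticial.{0}`
(`layer3ResidualOfRecord_of_compactInVerticial`), and the finite-graph residual `Layer3ResidualFinite` is a theorem outright
(`layer3ResidualFinite_holds`). No apex certificate of record (`abc_of_S*`, `abc_of_SH_v*`) imports `Layer3OfS`, so none binds the
refuted conjunct (tree scan 2026-08-26T11:2xZ: `Layer3OfS` is imported by `Summits.lean` only).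

HONEST FRAMING: what is refuted is OUR literal typing of [SemiAnbd] Def. 3.8 inside `Cor39` (cell finding t2g2-F1 / ruling χ2), not
[SemiAnbd] Cor. 3.9 as printed; nothing here asserts that abc is proved or refuted or takes a side on [IUTchIII] Cor. 3.12; typed ≠ proved;
a refuted binder makes a conditional theorem vacuous, not wrong. [claim: Mochizuki2012, status: disputed]
[cite: MochizukiSemiAnbd2006, Cor 3.9 p.42]
-/

namespace Summit.ABC.IUTFork.Conditional

open Literature.AnabelianGeometry.SemiGraphs

universe u₂ u₃ u₄ u₅

/-- **The LITERAL L3 residual of the Cor 3.12 cone is unsatisfiable at universe 0**: its third conjunct `Cor39.{0}` ([SemiAnbd] Cor. 3.9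
under the literal typing of Def. 3.8) is refuted by abc-iut-f-175's `IwahoriWitness.not_cor39` (p439444). K-hazard certificate: any theorem
taking `(h : Layer3Residual.{0})` is vacuously conditional. [claim: Mochizuki2012, status: disputed] -/
theorem not_layer3Residual : ¬ Layer3Residual.{0} :=
  fun h => IwahoriWitness.not_cor39 h.2.2

/-- Hence the literal L3 cone slice `Layer3Cone = Layer3Discharged ∧ Layer3Residual` is unsatisfiable at `u₁ = 0` as well (the discharged
half `layer3Discharged_holds` is a theorem; the residual half is refuted). [claim: Mochizuki2012, status: disputed] -/
theorem not_layer3Cone : ¬ Layer3Cone.{0, u₂, u₃, u₄, u₅} :=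
  fun h => not_layer3Residual h.2

/-- One-name form for hypothesis audits: at universe 0 the literal residual `Layer3Residual` is equivalent to `False`.
[claim: Mochizuki2012, status: disputed] -/
theorem layer3Residual_iff_false : Layer3Residual.{0} ↔ False :=
  ⟨not_layer3Residual, False.elim⟩

/-- **Unaffected, BY NAME (universe-0 instance of `layer3ResidualOfRecord_of_compactInVerticial`)**: the reading-of-record residual still
reduces to the one named fact [SemiAnbd] Thm 3.7 (iii) `CompactInVerticial`. Recorded next to the refutation so that the scoreboard reads
«literal binder refuted · binder of record = CompactInVerticial» from one module. Proves nothing new. [claim: Mochizuki2012, status: disputed] -/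
theorem layer3ResidualOfRecord_of_compactInVerticial_zero (h37iii : ProfiniteSemiGraph.CompactInVerticial.{0}) :
    Layer3ResidualOfRecord.{0} :=
  layer3ResidualOfRecord_of_compactInVerticial h37iii

/-- **Unaffected, BY NAME**: at finite semi-graphs the L3 residual of record is a theorem outright (`layer3ResidualFinite_holds`,
universe-0 instance). [claim: Mochizuki2012, status: disputed] -/
theorem layer3ResidualFinite_holds_zero : Layer3ResidualFinite.{0} :=
  layer3ResidualFinite_holds

end Summit.ABC.IUTFork.Conditional
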